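import Summits.NavierStokesRegularity.NavierStokesRegularity.Theorems.TypeICertificateLadderTargetRotationDefectBounds
import Literature.Analysis.FluidPDE.PineauVicolGaussSobolev
import HarnessLib

/-!
# Crux `Target` (stmt-NavierStokesRegularity-1217), line `killing-twisted-bernoulli-solitons`:
  weight lemmas for the ROTATION-DEFECT estimate (tool file 2 of 3 for stub B5b)

Support file (helpers only, `--supports stmt-NavierStokesRegularity-1217`). The rotation-defect
bound (`TypeICertificateLadderTargetRotationDefect.lean`) integrates Pineau–Vicol's Bernoulli
identity (4.3) against the `α = 0` conjugate weight `w = γ v` of Prop. 5.1′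
(arXiv:2607.09619, pp. 12–13; tree `PineauVicol2026.DriftHyp.exists_weight`: `v > 0` smooth,
`v, ∇v ∈ L²(γ)`, `γ = e^{−|y|²/4}`, two-sided Gaussian bounds). This file supplies the
weight-side facts used there:

* `rotationDefect_integrable_weight_mul` — polynomial growth × (weight ≤ `M e^{−|y|²/16}`) is
  integrable; `rotationDefect_memLp_two_gauss_of_poly`, `rotationDefect_integrable_gaussWeight_mul_mul`
  — polynomial growth is `L²(γ)`, and `γ f g ∈ L¹` for `f, g ∈ L²(γ)`;
* `rotationDefect_norm_gradient_weight_le` — `‖∇(γ v)‖ ≤ γ(‖∇v‖ + v|y|)`;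
  `rotationDefect_integrable_head_mul_gradient_weight` — `|Π| ‖∇w‖ ∈ L¹` for `Π` of quadratic
  growth (footnote 16's "mild decay information on `∇w`", here from the `L²(γ)` data by AM–GM);
* `rotationDefect_mul_setIntegral_ball_le` — `m e^{−7R²/16} ∫_{B_R} f ≤ ∫ w f` under the lower
  Gaussian bound; `rotationDefect_weighted_enstrophy_le` — from the weighted identity (5.4)
  `∫ w|Ω|² = α∫ wE` and `|E| ≤ ‖U + ½y‖‖RU‖`: `∫ w|Ω|² ≤ M|α| ∫ ‖U + ½y‖‖RU‖ e^{−|y|²/16}`.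

## References

* B. Pineau, V. Vicol, arXiv:2607.09619 (2026): Prop. 5.1, (5.3)–(5.4), footnote 16, proof of
  Thm. 1.4 for small `|α|` (pp. 12–13). [PineauVicol2026]
-/

noncomputable section

namespace Summit.NavierStokesRegularity.NavierStokesRegularity.Theorems

open MeasureTheory Set Function Filter Topology InnerProductSpace Real Metric
open scoped RealInnerProductSpace Laplacian ContDiff BigOperators ENNReal NNReal
open Literature.Analysis.FluidPDE Literature.Analysis.FluidPDE.PineauVicol2026

/-! ### Integrability against a Gaussian-dominated weight -/

/-- A continuous function of polynomial growth times a continuous weight dominated by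
`M e^{−|y|²/16}` is integrable on `ℝ³`. [folklore] -/
theorem rotationDefect_integrable_weight_mul {w g : EuclideanSpace ℝ (Fin 3) → ℝ}
    (hw : Continuous w) (hg : Continuous g) {M C : ℝ} {N : ℕ} (hw0 : ∀ y, 0 ≤ w y)
    (hwM : ∀ y, w y ≤ M * Real.exp (-(1 / 16 : ℝ) * ‖y‖ ^ 2))
    (hgC : ∀ y, |g y| ≤ C * (1 + ‖y‖) ^ N) :
    Integrable fun y => w y * g y := by
  refine rotationDefect_integrable_of_le_poly_gauss (hw.mul hg).aestronglyMeasurable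
    (C := M * C) (c := 1 / 16) (N := N) (by norm_num) fun y => ?_
  rw [Real.norm_eq_abs, abs_mul, abs_of_nonneg (hw0 y)]
  calc w y * |g y| ≤ M * Real.exp (-(1 / 16 : ℝ) * ‖y‖ ^ 2) * (C * (1 + ‖y‖) ^ N) :=
        mul_le_mul (hwM y) (hgC y) (abs_nonneg _) ((hw0 y).trans (hwM y))
    _ = M * C * ((1 + ‖y‖) ^ N * Real.exp (-(1 / 16 : ℝ) * ‖y‖ ^ 2)) := by ring

/-- `γ`-weighted products of two `L²(γ)` functions are Lebesgue integrable: if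
`f, g ∈ L²(γ dy)` then `γ f g ∈ L¹(dy)`. [folklore] -/
theorem rotationDefect_integrable_gaussWeight_mul_mul {f g : EuclideanSpace ℝ (Fin 3) → ℝ}
    (hf : MemLp f 2 (gaussMeasure (E := EuclideanSpace ℝ (Fin 3))))
    (hg : MemLp g 2 (gaussMeasure (E := EuclideanSpace ℝ (Fin 3)))) :
    Integrable fun y => gaussWeight y * (f y * g y) := by
  have h : Integrable (fun y => f y * g y) (gaussMeasure (E := EuclideanSpace ℝ (Fin 3))) :=
    hf.integrable_mul hg
  rw [integrable_gaussMeasure_iff] at h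
  simpa [smul_eq_mul] using h

/-- A continuous function of polynomial growth lies in `L²(γ)`. [folklore] -/
theorem rotationDefect_memLp_two_gauss_of_poly {f : EuclideanSpace ℝ (Fin 3) → ℝ}
    (hf : Continuous f) {C : ℝ} {N : ℕ} (hfC : ∀ y, |f y| ≤ C * (1 + ‖y‖) ^ N) :
    MemLp f 2 (gaussMeasure (E := EuclideanSpace ℝ (Fin 3))) := by
  have hmeas : AEStronglyMeasurable f (gaussMeasure (E := EuclideanSpace ℝ (Fin 3))) :=
    hf.aestronglyMeasurable.mono_ac gaussMeasure_absolutelyContinuous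
  rw [memLp_two_iff_integrable_sq_norm hmeas, integrable_gaussMeasure_iff]
  simp only [smul_eq_mul, Real.norm_eq_abs, sq_abs]
  refine rotationDefect_integrable_of_le_poly_gauss
    ((continuous_gaussWeight.mul (hf.pow 2)).aestronglyMeasurable)
    (C := C ^ 2) (c := 1 / 4) (N := N * 2) (by norm_num) fun y => ?_
  rw [Real.norm_eq_abs, abs_mul, abs_of_nonneg (gaussWeight_pos y).le, abs_of_nonneg (sq_nonneg _),
    gaussWeight, pow_mul]
  have h1 : f y ^ 2 ≤ (C * (1 + ‖y‖) ^ N) ^ 2 := by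
    rw [← sq_abs]
    exact pow_le_pow_left₀ (abs_nonneg _) (hfC y) 2
  have e : Real.exp (-‖y‖ ^ 2 / 4) = Real.exp (-(1 / 4 : ℝ) * ‖y‖ ^ 2) := by congr 1; ring
  rw [e]
  have hexp : 0 ≤ Real.exp (-(1 / 4 : ℝ) * ‖y‖ ^ 2) := (Real.exp_pos _).le
  calc Real.exp (-(1 / 4 : ℝ) * ‖y‖ ^ 2) * f y ^ 2
      ≤ Real.exp (-(1 / 4 : ℝ) * ‖y‖ ^ 2) * (C * (1 + ‖y‖) ^ N) ^ 2 :=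
        mul_le_mul_of_nonneg_left h1 hexp
    _ = C ^ 2 * (((1 + ‖y‖) ^ N) ^ 2 * Real.exp (-(1 / 4 : ℝ) * ‖y‖ ^ 2)) := by ring

/-- **Gradient of the weight `w = γ v`**: `‖∇w(y)‖ ≤ γ(y)(‖∇v(y)‖ + v(y)|y|)` for a positive
differentiable `v` (`∇γ = −½γ y`). [cite: PineauVicol2026, Prop. 5.1 (w = γ v) and footnote 16 (p. 12)] -/
theorem rotationDefect_norm_gradient_weight_le {v : EuclideanSpace ℝ (Fin 3) → ℝ}
    (hv : Differentiable ℝ v) (hvpos : ∀ y, 0 < v y) (y : EuclideanSpace ℝ (Fin 3)) :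
    ‖gradient (fun z => gaussWeight z * v z) y‖ ≤ gaussWeight y * (‖gradient v y‖ + v y * ‖y‖) := by
  have hγd : DifferentiableAt ℝ (gaussWeight : EuclideanSpace ℝ (Fin 3) → ℝ) y :=
    (contDiff_gaussWeight (n := 1)).differentiable (by simp) y
  have hprod : fderiv ℝ (fun z => gaussWeight z * v z) y =
      gaussWeight y • fderiv ℝ v y + v y • fderiv ℝ gaussWeight y := fderiv_fun_mul hγd (hv y)
  have e1 : ‖gradient (fun z => gaussWeight z * v z) y‖ = ‖fderiv ℝ (fun z => gaussWeight z * v z) y‖ := by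
    simp [gradient]
  have e2 : ‖gradient v y‖ = ‖fderiv ℝ v y‖ := by simp [gradient]
  have e3 : ‖fderiv ℝ (gaussWeight : EuclideanSpace ℝ (Fin 3) → ℝ) y‖ =
      ‖gradient (gaussWeight : EuclideanSpace ℝ (Fin 3) → ℝ) y‖ := by simp [gradient]
  have e4 : ‖gradient (gaussWeight : EuclideanSpace ℝ (Fin 3) → ℝ) y‖ =
      (1 / 2 : ℝ) * gaussWeight y * ‖y‖ := by
    rw [gradient_gaussWeight, norm_smul, Real.norm_eq_abs, abs_mul, abs_neg,
      abs_of_nonneg (by norm_num : (0:ℝ) ≤ 1 / 2), abs_of_nonneg (gaussWeight_pos y).le]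
  rw [e1, hprod]
  calc ‖gaussWeight y • fderiv ℝ v y + v y • fderiv ℝ gaussWeight y‖
      ≤ ‖gaussWeight y • fderiv ℝ v y‖ + ‖v y • fderiv ℝ gaussWeight y‖ := norm_add_le _ _
    _ = gaussWeight y * ‖gradient v y‖ + v y * ((1 / 2 : ℝ) * gaussWeight y * ‖y‖) := by
        rw [norm_smul, norm_smul, Real.norm_of_nonneg (gaussWeight_pos y).le,
          Real.norm_of_nonneg (hvpos y).le, e2, e3, e4]
    _ ≤ gaussWeight y * (‖gradient v y‖ + v y * ‖y‖) := by
        have : 0 ≤ gaussWeight y * (v y * ‖y‖) :=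
          mul_nonneg (gaussWeight_pos y).le (mul_nonneg (hvpos y).le (norm_nonneg y))
        nlinarith

/-- **`|Π| |∇w|` is integrable** for a continuous `Π` of quadratic growth and the weight
`w = γ v` of Prop. 5.1′ (`v > 0` smooth, `v, ∇v ∈ L²(γ)`): by `‖∇w‖ ≤ γ(‖∇v‖ + v|y|)` and
AM–GM, `|Π||∇w| ≤ γ(Π² + ‖∇v‖²) + γ((Π|y|)² + v²)`, each term Lebesgue integrable
(the "mild decay information on `∇w`" of footnote 16, in `L²(γ)` form). [cite: PineauVicol2026, footnote 16 (p. 12)] -/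
theorem rotationDefect_integrable_head_mul_gradient_weight {H v : EuclideanSpace ℝ (Fin 3) → ℝ}
    (hH : Continuous H) {A : ℝ} (hHpoly : ∀ y, |H y| ≤ A * (1 + ‖y‖) ^ 2)
    (hv : ContDiff ℝ ∞ v) (hvpos : ∀ y, 0 < v y)
    (hv2 : MemLp v 2 (gaussMeasure (E := EuclideanSpace ℝ (Fin 3))))
    (hG2 : MemLp (gradient v) 2 (gaussMeasure (E := EuclideanSpace ℝ (Fin 3)))) :
    Integrable fun y => |H y| * ‖gradient (fun z => gaussWeight z * v z) y‖ := by
  have hvd : Differentiable ℝ v := hv.differentiable (by simp)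
  have hw_smooth : ContDiff ℝ ∞ (fun z => gaussWeight z * v z) := contDiff_gaussWeight.mul hv
  have hsymmc : Continuous fun L : EuclideanSpace ℝ (Fin 3) →L[ℝ] ℝ =>
      (InnerProductSpace.toDual ℝ (EuclideanSpace ℝ (Fin 3))).symm L :=
    (InnerProductSpace.toDual ℝ (EuclideanSpace ℝ (Fin 3))).symm.continuous
  have hgradwc : Continuous (gradient fun z => gaussWeight z * v z) :=
    hsymmc.comp (hw_smooth.continuous_fderiv (by simp))
  have hHy_poly : ∀ y, |H y * ‖y‖| ≤ A * (1 + ‖y‖) ^ 3 := fun y => by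
    rw [abs_mul, abs_of_nonneg (norm_nonneg y)]
    have hA0 : 0 ≤ A * (1 + ‖y‖) ^ 2 := (abs_nonneg _).trans (hHpoly y)
    calc |H y| * ‖y‖ ≤ A * (1 + ‖y‖) ^ 2 * (1 + ‖y‖) :=
          mul_le_mul (hHpoly y) (by linarith [norm_nonneg y]) (norm_nonneg y) hA0
      _ = A * (1 + ‖y‖) ^ 3 := by ring
  have mH : MemLp H 2 (gaussMeasure (E := EuclideanSpace ℝ (Fin 3))) :=
    rotationDefect_memLp_two_gauss_of_poly hH hHpoly
  have mHy : MemLp (fun y => H y * ‖y‖) 2 (gaussMeasure (E := EuclideanSpace ℝ (Fin 3))) :=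
    rotationDefect_memLp_two_gauss_of_poly (hH.mul continuous_norm) hHy_poly
  have mGv : MemLp (fun y => ‖gradient v y‖) 2 (gaussMeasure (E := EuclideanSpace ℝ (Fin 3))) :=
    hG2.norm
  have I1 : Integrable fun y => gaussWeight y * (H y * H y) :=
    rotationDefect_integrable_gaussWeight_mul_mul mH mH
  have I2 : Integrable fun y => gaussWeight y * (‖gradient v y‖ * ‖gradient v y‖) :=
    rotationDefect_integrable_gaussWeight_mul_mul mGv mGv
  have I3 : Integrable fun y => gaussWeight y * ((H y * ‖y‖) * (H y * ‖y‖)) :=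
    rotationDefect_integrable_gaussWeight_mul_mul mHy mHy
  have I4 : Integrable fun y => gaussWeight y * (v y * v y) :=
    rotationDefect_integrable_gaussWeight_mul_mul hv2 hv2
  refine (((I1.add I2).add I3).add I4).mono'
    ((continuous_abs.comp hH).mul (continuous_norm.comp hgradwc)).aestronglyMeasurable
    (Eventually.of_forall fun y => ?_)
  rw [Real.norm_eq_abs, abs_mul, abs_abs, abs_of_nonneg (norm_nonneg _)]
  simp only [Pi.add_apply]
  have hγ := (gaussWeight_pos y).le
  have hHn := abs_nonneg (H y)
  have hyy := norm_nonneg y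
  have step : |H y| * ‖gradient (fun z => gaussWeight z * v z) y‖ ≤
      gaussWeight y * (|H y| * ‖gradient v y‖) + gaussWeight y * (|H y| * ‖y‖ * v y) := by
    have := mul_le_mul_of_nonneg_left (rotationDefect_norm_gradient_weight_le hvd hvpos y) hHn
    nlinarith
  have am1 : |H y| * ‖gradient v y‖ ≤ H y * H y + ‖gradient v y‖ * ‖gradient v y‖ := by
    rw [← abs_mul_abs_self (H y)]
    nlinarith [sq_nonneg (|H y| - ‖gradient v y‖)]
  have am2 : |H y| * ‖y‖ * v y ≤ (H y * ‖y‖) * (H y * ‖y‖) + v y * v y := by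
    have e : (H y * ‖y‖) * (H y * ‖y‖) = (|H y| * ‖y‖) * (|H y| * ‖y‖) := by
      rw [← abs_mul_abs_self (H y * ‖y‖), abs_mul, abs_of_nonneg hyy]
    rw [e]; nlinarith [sq_nonneg (|H y| * ‖y‖ - v y)]
  have k1 := mul_le_mul_of_nonneg_left am1 hγ
  have k2 := mul_le_mul_of_nonneg_left am2 hγ
  linarith

/-- **Lower Gaussian bound on a ball**: if `m e^{−7|y|²/16} ≤ w` then
`m e^{−7R²/16} ∫_{B_R} f ≤ ∫ w f` for continuous `f ≥ 0` with `w f` integrable. [folklore] -/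
theorem rotationDefect_mul_setIntegral_ball_le {w f : EuclideanSpace ℝ (Fin 3) → ℝ} {m R : ℝ}
    (hm : 0 ≤ m) (hw_low : ∀ y, m * Real.exp (-(7 / 16 : ℝ) * ‖y‖ ^ 2) ≤ w y)
    (hf : Continuous f) (hf0 : ∀ y, 0 ≤ f y) (hwf : Integrable fun y => w y * f y) :
    m * Real.exp (-(7 / 16 : ℝ) * R ^ 2) * ∫ y in ball (0 : EuclideanSpace ℝ (Fin 3)) R, f y ≤
      ∫ y, w y * f y := by
  set L : ℝ := m * Real.exp (-(7 / 16 : ℝ) * R ^ 2) with hL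
  have i1 : IntegrableOn (fun y => L * f y) (ball (0 : EuclideanSpace ℝ (Fin 3)) R) :=
    ((continuous_const.mul hf).continuousOn.integrableOn_compact (isCompact_closedBall 0 R)).mono_set
      ball_subset_closedBall
  have hmono : ∫ y in ball (0 : EuclideanSpace ℝ (Fin 3)) R, L * f y ≤
      ∫ y in ball (0 : EuclideanSpace ℝ (Fin 3)) R, w y * f y := by
    refine setIntegral_mono_on i1 hwf.integrableOn measurableSet_ball fun y hy => ?_
    have hyR : ‖y‖ < R := by simpa using hy
    have hLw : L ≤ w y := by
      refine le_trans ?_ (hw_low y)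
      refine mul_le_mul_of_nonneg_left (Real.exp_le_exp.2 ?_) hm
      have : ‖y‖ ^ 2 ≤ R ^ 2 := pow_le_pow_left₀ (norm_nonneg y) hyR.le 2
      nlinarith
    exact mul_le_mul_of_nonneg_right hLw (hf0 y)
  have hw0 : ∀ y, 0 ≤ w y := fun y =>
    le_trans (mul_nonneg hm (Real.exp_pos _).le) (hw_low y)
  have hle : ∫ y in ball (0 : EuclideanSpace ℝ (Fin 3)) R, w y * f y ≤ ∫ y, w y * f y :=
    setIntegral_le_integral hwf (Eventually.of_forall fun y => mul_nonneg (hw0 y) (hf0 y))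
  rw [integral_const_mul] at hmono
  exact hmono.trans hle

/-- **From the weighted identity to the rotation-defect integral.** If `∫ w|Ω|² = α ∫ wE`
((5.4)) for a weight `0 ≤ w ≤ M e^{−|y|²/16}`, then
`∫ w |Ω|² ≤ M |α| ∫ ‖U + ½y‖‖RU‖ e^{−|y|²/16}` (`|E| ≤ ‖U + ½y‖‖RU‖` pointwise). [cite: PineauVicol2026, proof of Thm. 1.4 small |α| (p. 13)] -/
theorem rotationDefect_weighted_enstrophy_le
    {U : EuclideanSpace ℝ (Fin 3) → EuclideanSpace ℝ (Fin 3)} {w : EuclideanSpace ℝ (Fin 3) → ℝ}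
    {α M : ℝ} (hw0 : ∀ y, 0 ≤ w y) (hwM : ∀ y, w y ≤ M * Real.exp (-(1 / 16 : ℝ) * ‖y‖ ^ 2))
    (h54 : ∫ y, w y * ‖curl U y‖ ^ 2 = α * ∫ y, w y * ((1 / 2 : ℝ) * ⟪rotGen y, U y⟫ +
      ⟪U y + (1 / 2 : ℝ) • y, fderiv ℝ U y (rotGen y)⟫))
    (iE : Integrable fun y => w y * ((1 / 2 : ℝ) * ⟪rotGen y, U y⟫ +
      ⟪U y + (1 / 2 : ℝ) • y, fderiv ℝ U y (rotGen y)⟫))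
    (iF : Integrable fun y => ‖U y + (1 / 2 : ℝ) • y‖ *
      ‖rotGen (U y) - fderiv ℝ U y (rotGen y)‖ * Real.exp (-‖y‖ ^ 2 / 16)) :
    ∫ y, w y * ‖curl U y‖ ^ 2 ≤ M * (|α| * ∫ y, ‖U y + (1 / 2 : ℝ) • y‖ *
      ‖rotGen (U y) - fderiv ℝ U y (rotGen y)‖ * Real.exp (-‖y‖ ^ 2 / 16)) := by
  rw [h54]
  set Ev : EuclideanSpace ℝ (Fin 3) → ℝ := fun y => (1 / 2 : ℝ) * ⟪rotGen y, U y⟫ +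
      ⟪U y + (1 / 2 : ℝ) • y, fderiv ℝ U y (rotGen y)⟫ with hEv
  set F : EuclideanSpace ℝ (Fin 3) → ℝ := fun y => ‖U y + (1 / 2 : ℝ) • y‖ *
      ‖rotGen (U y) - fderiv ℝ U y (rotGen y)‖ * Real.exp (-‖y‖ ^ 2 / 16) with hF
  have h1 : α * ∫ y, w y * Ev y ≤ |α| * ∫ y, |w y * Ev y| := by
    have := le_abs_self (α * ∫ y, w y * Ev y)
    rw [abs_mul] at this
    refine this.trans (mul_le_mul_of_nonneg_left ?_ (abs_nonneg α))
    have h := norm_integral_le_integral_norm (μ := volume) fun y => w y * Ev y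
    simpa only [Real.norm_eq_abs] using h
  have h2 : ∫ y, |w y * Ev y| ≤ ∫ y, M * F y := by
    refine integral_mono iE.abs (iF.const_mul M) fun y => ?_
    simp only [hEv, hF]
    rw [abs_mul, abs_of_nonneg (hw0 y)]
    have e : Real.exp (-‖y‖ ^ 2 / 16) = Real.exp (-(1 / 16 : ℝ) * ‖y‖ ^ 2) := by congr 1; ring
    rw [e]
    have hE := rotationDefect_abs_errorTerm_le U y
    calc w y * |(1 / 2 : ℝ) * ⟪rotGen y, U y⟫ + ⟪U y + (1 / 2 : ℝ) • y, fderiv ℝ U y (rotGen y)⟫|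
        ≤ M * Real.exp (-(1 / 16 : ℝ) * ‖y‖ ^ 2) *
          (‖U y + (1 / 2 : ℝ) • y‖ * ‖rotGen (U y) - fderiv ℝ U y (rotGen y)‖) :=
          mul_le_mul (hwM y) hE (abs_nonneg _) ((hw0 y).trans (hwM y))
      _ = M * (‖U y + (1 / 2 : ℝ) • y‖ * ‖rotGen (U y) - fderiv ℝ U y (rotGen y)‖ *
          Real.exp (-(1 / 16 : ℝ) * ‖y‖ ^ 2)) := by ring
  rw [integral_const_mul] at h2
  calc α * ∫ y, w y * Ev y ≤ |α| * ∫ y, |w y * Ev y| := h1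
    _ ≤ |α| * (M * ∫ y, F y) := mul_le_mul_of_nonneg_left h2 (abs_nonneg α)
    _ = M * (|α| * ∫ y, F y) := by ring


/-! ### Registered form -/

/-- **Registered helper stub `rotationDefect_weightedEnstrophyBound`** (explicit-binder form of
`rotationDefect_weighted_enstrophy_le`): from the weighted identity (5.4) for a weight
`0 ≤ w ≤ M e^{−|y|²/16}`, `∫ w|Ω|² ≤ M|α| ∫ ‖U + ½y‖‖RU‖ e^{−|y|²/16}`.
[cite: PineauVicol2026, proof of Thm. 1.4 small |α| (p. 13)] -/
theorem rotationDefect_weightedEnstrophyBound :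
    ∀ (U : EuclideanSpace ℝ (Fin 3) → EuclideanSpace ℝ (Fin 3)) (w : EuclideanSpace ℝ (Fin 3) → ℝ) (α M : ℝ), (∀ y : EuclideanSpace ℝ (Fin 3), 0 ≤ w y) → (∀ y : EuclideanSpace ℝ (Fin 3), w y ≤ M * Real.exp (-(1 / 16 : ℝ) * ‖y‖ ^ 2)) → (∫ y : EuclideanSpace ℝ (Fin 3), w y * ‖Literature.Analysis.FluidPDE.curl U y‖ ^ 2 = α * ∫ y : EuclideanSpace ℝ (Fin 3), w y * ((1 / 2 : ℝ) * inner ℝ (Literature.Analysis.FluidPDE.rotGen y) (U y) + inner ℝ (U y + (1 / 2 : ℝ) • y) (fderiv ℝ U y (Literature.Analysis.FluidPDE.rotGen y)))) → MeasureTheory.Integrable (fun y : EuclideanSpace ℝ (Fin 3) => w y * ((1 / 2 : ℝ) * inner ℝ (Literature.Analysis.FluidPDE.rotGen y) (U y) + inner ℝ (U y + (1 / 2 : ℝ) • y) (fderiv ℝ U y (Literature.Analysis.FluidPDE.rotGen y)))) → MeasureTheory.Integrable (fun y : EuclideanSpace ℝ (Fin 3) => ‖U y + (1 / 2 : ℝ)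 • y‖ * ‖Literature.Analysis.FluidPDE.rotGen (U y) - fderiv ℝ U y (Literature.Analysis.FluidPDE.rotGen y)‖ * Real.exp (-‖y‖ ^ 2 / 16)) → ∫ y : EuclideanSpace ℝ (Fin 3), w y * ‖Literature.Analysis.FluidPDE.curl U y‖ ^ 2 ≤ M * (|α| * ∫ y : EuclideanSpace ℝ (Fin 3), ‖U y + (1 / 2 : ℝ) • y‖ * ‖Literature.Analysis.FluidPDE.rotGen (U y) - fderiv ℝ U y (Literature.Analysis.FluidPDE.rotGen y)‖ * Real.exp (-‖y‖ ^ 2 / 16)) :=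
  fun _ _ _ _ hw0 hwM h54 iE iF => rotationDefect_weighted_enstrophy_le hw0 hwM h54 iE iF

end Summit.NavierStokesRegularity.NavierStokesRegularity.Theorems

end
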